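import Mathlib
import HarnessLib
import HarnessLib.Audit
import Summits.PneNP.Statement
import Literature.Computability.Complexity.ConstantDepth
import Literature.Computability.Complexity.Classes
import Literature.Computability.Complexity.GraphEncodings
import HarnessLib.Audit.Status.Attr

/-!
Route: SymmetryBudget

CLOSED (superseded) 2026-08-17T16:19:59Z by planner-rfix-PneNP-SymmetryBudget-96ea8770-0 — reason: superseded:route-PneNP-circuit — superseded by route-PneNP-circuit — note: superseded by route-PneNP-circuit (NP ⊄ P/poly): census 2026-08-17. Trigger: support WindowBarrier (stmt-PneNP-2145) refuted-substantive by Summit.PneNP.PneNP.Theorems.not_WindowBarrier (p169927) via NoHiddenOrder_proof (p169810: poly-size Bud(m,⌊log₂ m⌋)-symmetric window canoniser, uniform in the p. The file is kept as the record of this route; refuted decls are indexed as negative knowledge (`ledger negatives`).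

# Route PneNP/SymmetryBudget — "inside the symmetrisation window Hamiltonicity stays symmetric-hard,
and a polynomial-time HAM decider would compile into symmetric circuits there" (idea card
canonisation-cliff-symmetry-budget)

Model. Inputs are m × m Boolean matrices x read as the simple graph Gr(x) (symmetrised, loops
dropped — the decoding convention of `Literature.Computability.Complexity.encodingGraphFin`). The
SYMMETRY BUDGET is the group Bud(m,g) = {ρ ∈ Sym(Fin m) | ρ i = i whenever i + g < m}: the first m −
g vertices are individualised, the last g are free (Bud ≅ Sym_g). A threshold circuit C (gates from
`tcBasis`, straight-line `Circuit (Fin m × Fin m)`) is Bud-SYMMETRIC if every ρ ∈ Bud extends to an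
automorphism of C: a permutation σ of the gates fixing the output wire, preserving gate labels, and
carrying the multiset of argument wires of gate j — inputs relabelled by ρ × ρ, gates by σ — onto
that of σ j (Anderson–Dawar 2017 §2; Dawar–Wilsenach, ToC 21 (2025) §2.5). The predicate is written
INLINE (`let Sym := …`) in every item until the definition request SymmetricCircuit lands; it is
sanity-checked in the planner folder (SymTest.lean, sorry-free: the AND of all inputs is Sym(Fin
2)-symmetric, a gate singling out input (0,1) is not).

Thesis X (it suffices to show) = WindowHam ∧ HamCompiles at the window scale g(m) = ⌊log₂ m⌋:
 (WindowHam, crux 2) for every polynomial p there are infinitely many m such that NO Bud(m,⌊log₂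
m⌋)-symmetric threshold circuit of size ≤ p(m) computes x ↦ [Gr(x) is Hamiltonian];
 (HamCompiles, crux 3) if NP ⊆ P over {0,1} (Cook's classes: `PNPWave0.NP Bool ⊆ PNPWave0.P Bool`;
equivalently HAMCIRCUIT ∈ P, by Karp-completeness of HAM and the proved model bridges) then for some
polynomial p and EVERY m some Bud(m,⌊log₂ m⌋)-symmetric threshold circuit of size ≤ p(m) computes x
↦ [Gr(x) is Hamiltonian].
Lean: both are one-line Props over Mathlib + `Literature.Computability.Complexity.{Circuit, tcBasis,
PNPWave0.NP, PNPWave0.P}` (decls WindowHam, HamCompiles below; the support/barrier items also use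
`B2`, `Classes.P`, `encodingGraph`; whole route file lean check rc 0 with the deciding theorem,
route-repair 2026-08-15).

Deciding theorem X → PneNP (`closes`, D-0027 §2.1; the item Assembly restates it as one Prop,
WindowHam → HamCompiles → PneNP with the hypotheses inline, provable now by the same argument):
WindowHam → HamCompiles → PneNP, five lines of logic — if ¬PneNP then every L ∈ NP Bool lies in P
Bool, i.e. NP Bool ⊆ P Bool; HamCompiles then yields a polynomial p with Bud(m,⌊log₂ m⌋)-symmetric
threshold circuits of size ≤ p(m) for Hamiltonicity at EVERY m, contradicting WindowHam at p (∃ᶠ m,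
¬HasSym). No Literature fact, proved or unproved, is load-bearing in the glue or left in the route's
cone (the model bridges P_bool_eq / NP_bool_eq and HAMCIRCUIT_mem_NP are needed only INSIDE a future
proof of HamCompiles, to pass from NP ⊆ P to HAMCIRCUIT ∈ Classes.P); the two `let` vocabularies are
syntactically identical, so the contradiction is literal.

Why the window (the card's cliff, computed). Symmetrising a circuit over Bud costs the factor |Bud|
= g! (support item Symmetrise), so for g = O(log m / log log m) 'Bud-symmetric poly-size' =
'poly-size' on invariant functions, and a symmetric HAM lower bound there is VERBATIM HAMCIRCUIT ∉
PPoly (route Circuit's target): the BRIDGE edge. For g = ω(log m) the Dawar–Wilsenach support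
theorem (orbit ≤ C(g,k), k ≤ g/4 ⇒ supports < k; ToCL 2022 Thm 4.10 = ToC 2025 Thm 6.2) with linear
counting width of CFI and of Hamiltonicity (Cai–Fürer–Immerman 1992; arXiv:1901.07825 Lemma 14)
makes BOTH 'some P property is Bud-symmetric-hard' and 'HAM is Bud-symmetric-hard' theorems (support
items PolylogBarrier, PolylogHam at g = ⌊log₂ m⌋²): the BARRIER edge, where symmetric lower bounds
imply nothing about P. In between, for log m / log log m ≪ g ≤ O(log m), g! is superpolynomial (no
symmetrisation) while poly(m) ≥ 2^g buys a gate for every SUBSET of the free part, which voids every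
support theorem and disarms every published symmetric-hardness witness (CFI graphs, vertex-variable
𝔽₂-systems and bounded-domain CSPs planted on the free vertices fall to subset-indexed equivariant
brute force, orbits ≤ 2^g ≤ m), yet HAM stays NP-hard because m − g vertices are ordered. WindowHam
is therefore the first symmetric lower bound beyond supports (implied by NP ⊄ P/poly, implying
nothing known), and HamCompiles the HAM-specific equivariant compilation that turns it into P ≠ NP;
crux 4 (WindowBarrier: some P-time invariant property is symmetric-hard in the window) is the
locality-type barrier saying the compilation cannot be generic.

Rationale: WHY THIS LINE (finite model theory / permutation-group supports brought to bear on circuit lower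
bounds). Symmetric threshold circuits are the one general-gate model with unconditional exponential
lower bounds for NP-complete graph properties (Anderson–Dawar doi:10.1007/s00224-016-9692-2 Thm 1
with Dawar 1998; Dawar–Wilsenach doi:10.4086/toc.2025.v021a014 Thms 6.2–6.4) and they interpolate to
P/poly along the symmetry budget g (number of non-individualised vertices): symmetrisation costs g!
(item Symmetrise). The card's cliff is two-sided but its provable edges do not meet — bridge iff g!
≤ poly (g = O(log m/log log m)); barrier by supports + counting width only for g = ω(log m), because
the support theorem (doi:10.1145/3476227 Thm 4.10) needs orbits ≤ C(g,k) and poly(m) ≥ 2^g voids it.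
The route puts the thesis in the gap, g = ⌊log₂ m⌋, where (i) a symmetric lower bound for HAM is not
a general circuit lower bound in disguise (g! = m^{Θ(log log m)}), (ii) every published
symmetric-hardness witness for P is disarmed by subset-indexed brute force (orbits ≤ 2^g ≤ m), (iii)
HAM stays NP-hard since m − g vertices are ordered. Imported: supports/orbits (arXiv:1401.1125 §3;
doi:10.1145/3476227), counting width (CaiFurerImmerman1992; arXiv:1901.07825 Lemmas 13–14), and the
magnification/locality template (arXiv:1911.08297) as the map of where a symmetric bound can pay.
Catalogue: none of the physical/probabilistic analogies; this is a restricted-model + transfer-lemma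
line with an explicit group-theoretic dictionary (budget = point stabiliser, transfer cost = index).

RANKED CRUXES. #2 WindowHam — HAM has no poly-size Bud(m,⌊log₂ m⌋)-symmetric threshold circuits
(i.o.): first symmetric bound beyond supports; needs an invariant for orbits in (2^g, g!) ('ordered
supports', orbit growth along vertex duplication). #3 HamCompiles — NP ⊆ P (Cook's classes over
{0,1}; equivalently HAMCIRCUIT ∈ P) ⇒ poly-size Bud(m,⌊log₂ m⌋)-symmetric circuits for HAM at every
m: equivariant compilation (order free vertices by their neighbourhoods in the ordered part, absorb
residual twin classes by subset DP with count summaries); approachable now, decisive for the route's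
meaning (proved ⇒ WindowHam sits between P ≠ NP and NP ⊄ P/poly). #4 WindowBarrier — some P language
with Bud-invariant slices is symmetric-hard at g = ⌊log₂ m⌋ (candidates: pair-variable 𝔽₂-systems;
isomorphism of the free part to an ordered pattern, in P by Babai–Luks): the locality analogue;
proved ⇒ only problem-specific bridges like #3 can pay; refuted ⇒ every symmetric bound in the
window is P-hardness.
SUPPORT (theorem-level, documents the cliff; not staffing keys): Symmetrise (g!-sandwich,
elementary, also the canary of the inline predicate); PolylogBarrier, PolylogHam (g = ⌊log₂ m⌋²: a P
property resp. HAM has no poly-size Bud-symmetric threshold circuits — Thm 4.10 transferred to the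
point stabiliser + linear counting width of CFI resp. Hamiltonian path planted on the free part);
RigidBenchmark (full symmetry, colour-refinement-discrete inputs, 3-colourability: the card's
rigid-instance target, equivalent to NPNotSubsetPPoly via pendant-path rigidification and symmetric
colour refinement — calibration for any non-WL symmetric technique).

KILL CRITERIA. HamCompiles refuted is impossible without NP ⊆ P (its hypothesis; ¬HamCompiles ⊢
¬PneNP); HamCompiles shown UNPROVABLE-in-principle is not a thing — the operational kill is: a
theorem that some explicit NP-complete invariant property provably needs superpolynomial Bud(m,log
m)-symmetric size EVEN relative to a HAM oracle on ordered sub-instances (then the compilation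
cannot exist and the route closes `exhausted` with that census). WindowHam refuted (poly-size
symmetric HAM circuits in the window) closes the route `refuted` and is itself news. WindowBarrier
proved does NOT close the route (it kills only the generic bridge, which is not filed);
WindowBarrier refuted upgrades WindowHam to P-hardness outright. Symmetrise refuted can only mean
the inline Sym predicate is mis-specified: restate every item over the landed SymmetricCircuit
definition. PolylogBarrier/PolylogHam refuted ⇒ the support-theorem transfer to Bud fails; re-derive
the barrier edge before trusting the window arithmetic.

DELIBERATELY NOT DECOMPOSED. The invariant meant to prove WindowHam; an oracle form of HamCompiles
(symmetric circuits with HAM-oracle gates on canonically ordered sub-instances — needs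
ordered-argument gates, outside the inline predicate); the colour-class coordinate of the budget (Γ
= ∏ Sym(block): bridge at class size ≤ 3 by Immerman–Lander canonisation, CFI barrier at ≥ 4 for the
threshold basis; richer symmetric bases move that cliff and belong to route Descriptive's CPT crux);
the uniform/FPC phrasing ('FPC with ⌊log₂ m⌋ constants captures P on such structures'); arithmetic
(VP) analogues. Definition requests: SymmetricCircuit — LANDED as
Literature/Computability/Complexity/SymmetricCircuit.lean (Circuit.IsSymmetricUnder, Supports,
HasSymCircuit; grounder note 2026-08-15), so the eight inline `let Sym` preludes may be restated
over it in tenure (or bridged once by a prover lemma `Sym m Γ C ↔ C.IsSymmetricUnder Γ`),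
deliberately not done in the glue repair; ColourRefinementDiscrete, CountingWidth still wanted; fact
requests: DW ToCL 2022 Thm 4.10 (= ToC 2025 Thm 6.2; not in tree, acq-03322 filed by the grounder),
AD 2017 Thm 6, arXiv:1901.07825 Lemmas 13–14.

CHEAPEST FALSIFIER. Symmetrise (support, elementary) is the canary of the inline symmetry predicate:
if the `let Sym` clause were uninhabited by the AND-of-relabelled-copies construction, every ¬HasSym
item (WindowHam, WindowBarrier, PolylogBarrier, PolylogHam) would be vacuous and the line void —
prove Symmetrise first (the route reviews' SymTest.lean already checks inhabitation: the AND of all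
inputs is Sym-symmetric at every m, a gate singling out input (0,1) is not). For the thesis proper
the cheapest kill is the free-part-only test from the route review: with the ordered part frozen to
a fixed Hamiltonian path joined to all free vertices, Held–Karp over SUBSETS of the g free vertices
is itself Sym_g-symmetric of size 2^{O(g)} = poly(m) at g = ⌊log₂ m⌋, so any candidate WindowHam
invariant that ignores the ordered part is refuted at once, and an actual poly-size Bud(m,⌊log₂
m⌋)-symmetric HAM circuit (¬WindowHam) closes the route `refuted`.

Novelty: Nearest prior art: the Dawar programme — doi:10.1007/s00224-016-9692-2 (symmetric threshold circuits
= FPC, support theorem), doi:10.1145/3476227 Thm 4.10 + doi:10.4086/toc.2025.v021a014 Thms 6.2–6.4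
(orbits → supports → counting width; the symmetry GROUP as a dial for Det/Perm, also
doi:10.4230/lipics.itcs.2022.52), doi:10.1145/3456297 (symmetric LPs; linear counting width of HAM,
arXiv:1901.07825 Lemma 14), He–Rossman doi:10.4230/lipics.itcs.2023.68 (group-graded symmetric
formulas), the g!-symmetrisation remark, and magnification/locality arXiv:1911.08297; the card
canonisation-cliff-symmetry-budget (new-combination, twice audited) supplies the individualisation
coordinate g and the two-sided cliff. DELTA: (i) the cliff's provable edges are located for the
threshold basis — bridge iff g! ≤ poly (g = O(log m/log log m)); support-theorem barrier only for g
= ω(log m), since Thm 4.10 needs orbits ≤ C(g,k) and poly(m) ≥ 2^g voids it — and the thesis is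
placed in the gap g = ⌊log₂ m⌋, not at the bridge edge where the card's X is verbatim HAMCIRCUIT ∉
PPoly (route Circuit); (ii) the gap is split into a lower-bound crux WindowHam (first symmetric
bound beyond supports; implied by NP ⊄ P/poly, implies nothing known) and an equivariant-compilation
crux HamCompiles, whose conjunction gives P ≠ NP with no unproved fact load-bearing — a
restricted-model statement sandwiched between P ≠ NP and NP ⊄ P/poly, not found in print; (iii) at
scale log m every published symmetric-hardness witn  [refs: 10.1007/s00224-016-9692-2, 10.1145/3476227, 10.4086/toc.2025.v021a014, 10.4230/lipics.itcs.2022.52, 10.1145/3456297, 10.4230/lipics.itcs.2023.68, 10.4230/lipics.icalp.2024.1, 1901.07825, 1911.08297, 1401.1125, 1804.02939, 1705.03283, 2212.09285, doi:10.1007/s00224-016-9692-2, doi:10.1145/3476227, doi:10.4086/toc.2025.v021a014, doi:10.4230/lipics.itcs.2022.52, doi:10.1145/3456297, doi:10.4230/lipic]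

Barriers (technique_class: symmetric-circuits, support-theorems, counting-width): technique_class: symmetric-circuits, support-theorems, counting-width
- Literature.Barriers.PneNP.NaturalProofs: not formally met — "no poly-size Bud(m,⌊log₂
m⌋)-symmetric threshold circuit" is a property of Bud-invariant functions (not large) over a
syntactically restricted model below the g!·poly transfer line; a useful natural property would need
PRF ∘ (canonisation of the free part relative to the ordered part), which is the candidate HARD
function of WindowBarrier, not a symmetric-cheap one; via HamCompiles the conclusion is P ≠ NP
(uniform), so RR is not triggered by the conclusion either. The bet: an orbit/'ordered-support'
invariant of symmetric circuits with orbits in (2^g, g!).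
- Literature.Barriers.PneNP.Locality: met in spirit and filed as items — WindowBarrier is the
symmetric analogue of a localising lower bound (a P-time planted property hard for the same model),
PolylogBarrier its provable polylog version; evaded only through HamCompiles, a HAM-specific
compilation that a generic all-of-P bridge probably cannot have. WindowBarrier proved ∧ HamCompiles
refuted = line dead, as CHOPRS predicts for localisable techniques.
- Literature.Barriers.PneNP.TSPExtensionComplexity: nearest restricted-symmetric precedent
(symmetric LPs); full-symmetry lower bounds for HAM/TSP are theorems (arXiv:1901.07825) and, like
PolylogHam, imply nothing about P — hence the thesis sits at partial symmetry g = ⌊log₂ m⌋, where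
symmetrisation is unaffordable but the ordered part keeps HAM

History (route lifecycle, newest last):
- 2026-08-15T16:19:55Z · rev 2: restated HamCompiles (stmt-PneNP-2144), Assembly (stmt-PneNP-2150) — route-repair (rbadge g2): re-route around the NP model bridge — HamCompiles hypothesis HAMCIRCUIT ∈ Classes.P → PNPWave0.NP Bool ⊆ PNPWave0.P Bool (Cook classes (planner-rbadge-PneNP-SymmetryBudget-96ea8770-g2-0)
- 2026-08-17T16:01:04Z · BROKEN — WindowBarrier (stmt-PneNP-2145, support) refuted by Summit.PneNP.PneNP.Theorems.not_WindowBarrier @ b55265987de5 (prover-PneNP-route-PneNP-SymmetryBudget-3)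
- 2026-08-17T16:19:59Z · CLOSED superseded — superseded:route-PneNP-circuit (planner-rfix-PneNP-SymmetryBudget-96ea8770-0)

sub-problem: PneNP · status: closed(superseded) · opened planner-plancard-PneNP-PneNP-canonisation-cli-3db5e158-0 2026-08-15T11:01:20Z · rev 6 · ledger route-PneNP-SymmetryBudget
GENERATED by the gate from the ledger (D-0016/17). Provers cite these decls: `theorem foo : Summit.PneNP.PneNP.Theses.SymmetryBudget.<Decl> := …` in Summits/PneNP/PneNP/Theorems/<Name>.lean.
-/

namespace Summit.PneNP.PneNP.Theses.SymmetryBudget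

open scoped BigOperators Topology Manifold Classical MeasureTheory ProbabilityTheory Matrix InnerProductSpace ComplexConjugate ContinuousMap
open Filter Set Function TopologicalSpace MeasureTheory

attribute [summit_statement] _root_.PneNP

open Literature.PNP

/-- item stmt-PneNP-2143 · crux · rank 2 · closed · moot by None · by planner
why it might fail: False only if HAM has poly-size Bud(m,log m)-symmetric circuits (⇒ NP ⊆ P/poly-type collapse via the ordered part); the live risk is UNPROVABILITY: every symmetric lower bound in print goes through supports/counting width, void once size ≥ 2^g (DW ToC 2025 Thm 6.2 = ToCL 2022 Thm 4.10).
sources: doi:10.4086/toc.2025.v021a014 Thm 6.2, Thm 6.4 (p.17), doi:10.1145/3476227 Thm 4.10, doi:10.1007/s00224-016-9692-2 Thm 21 (arXiv:1401.1125 p.10), Thm 1, arXiv:1901.07825 Lemma 14 (linear counting width of HAM), KarpLipton1980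
HAM is symmetric-hard INSIDE the window: for every polynomial p there are infinitely many m such
that no Bud(m,⌊log₂ m⌋)-symmetric threshold circuit of size ≤ p(m) computes x ↦ [Gr(x) is
Hamiltonian]. Implied by HAMCIRCUIT ∉ PPoly (symmetric ⊆ general, tcBasis→B2 is polynomial); implies
nothing known, because symmetrising a general circuit costs |Bud| = ⌊log₂ m⌋! = m^{Θ(log log m)}.
Known technique is void here: the Dawar–Wilsenach support theorem needs orbits ≤ C(g,k) (k ≤ g/4)
and poly(m) ≥ 2^g = 2^{⌊log₂ m⌋} exceeds C(g,g/2); a proof needs an invariant of symmetric circuits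
with orbits in (2^g, g!) ('ordered supports'). Hardest and most informative crux; with HamCompiles
it gives PneNP (Assembly). Model: inputs are m×m Boolean matrices x read as the simple graph Gr(x) =
SimpleGraph.fromRel (x(u,v) = true) (symmetrised, loops dropped, as in encodingGraphFin); Bud(m,g) =
permutations of Fin m fixing every i with i+g < m (last g vertices free); a `tcBasis` circuit C on
Fin m × Fin m is Bud-symmetric (inline `let Sym`) iff every ρ ∈ Bud extends to a gate permutation σ
fixing the output wire, preserving gate labels and mapping the argument multiset of gate j,
relabelled by ρ×ρ on inp -/
@[route_item "route-PneNP-SymmetryBudget", crux]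
def WindowHam : Prop :=
  let Sym : (m : ℕ) → Set (Equiv.Perm (Fin m)) → Literature.Computability.Complexity.Circuit (Fin m × Fin m) → Prop := fun m Γ C => ∀ ρ ∈ Γ, ∃ σ : Equiv.Perm (Fin C.gates.length), Sum.map (fun q : Fin m × Fin m => (ρ q.1, ρ q.2)) (fun k : ℕ => if h : k < C.gates.length then ((σ ⟨k, h⟩ : Fin C.gates.length) : ℕ) else k) C.output = C.output ∧ ∀ j : Fin C.gates.length, (C.gates[σ j]).fn = (C.gates[j]).fn ∧ (List.ofFn (C.gates[σ j]).args).Perm ((List.ofFn (C.gates[j]).args).map (Sum.map (fun q : Fin m × Fin m => (ρ q.1, ρ q.2)) (fun k : ℕ => if h : k < C.gates.length then ((σ ⟨k, h⟩ : Fin C.gates.length) : ℕ) else k))); let HasSym : (m : ℕ) → Set (Equiv.Perm (Fin m)) → ℕ → ((Fin m × Fin m → Bool) → Bool) → Prop := fun m Γ s f => ∃ C : Literature.Computability.Complexity.Circuit (Fin m × Fin m), C.IsOver Literature.Computability.Complexity.tcBasis ∧ C.size ≤ s ∧ Sym m Γ C ∧ C.Computes f; let Bud : (m : ℕ) → ℕ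 → Set (Equiv.Perm (Fin m)) := fun m g => {ρ | ∀ i : Fin m, (i : ℕ) + g < m → ρ i = i}; let Gr : (m : ℕ) → (Fin m × Fin m → Bool) → SimpleGraph (Fin m) := fun m x => SimpleGraph.fromRel fun u v => x (u, v) = true; ∀ p : Polynomial ℕ, ∃ᶠ m in Filter.atTop, ¬ HasSym m (Bud m (Nat.log 2 m)) (p.eval m) (fun x : Fin m × Fin m → Bool => decide (Gr m x).IsHamiltonian)

-- earlier HamCompiles (stmt-PneNP-2144, replaced 2026-08-15T16:19:55Z -> stmt-PneNP-10637): retired by None — let Sym : (m : ℕ) → Set (Equiv.Perm (Fin m)) → Literature.Computability.Complexity.Circuit (Fin m × Fin m) → Prop := fun m Γ C => ∀ ρ ∈ Γ, ∃ σ : Equiv.Perm (Fin C.gates.length), Sum.map (fun q : Fin m × Fin m => (ρ q.1, ρ q.2)) (fun k : ℕ => if h : k < C.gates.length then ((σ ⟨k, h⟩ : Fin C.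
/-- item stmt-PneNP-10637 · crux · rank 3 · closed · proved by Summit.PneNP.PneNP.Theorems.HamCompiles_proof @ b1634edc3df5 (prover) · by planner
why it might fail: The compilation may not exist: r twin classes of free vertices of size g/r with √(g/log g) ≲ r ≲ g/log g defeat both in-class ordering (cost ((g/r)!)^r) and count summaries ((g+1)^r DP states); no equivariant-compilation result of this kind is in print.
sources: doi:10.1007/s00224-016-9692-2 Thm 1 (FPC → P-uniform symmetric threshold circuits: the compilation template), arXiv:1705.03283 (Neuen–Schweitzer: exponential lower bounds for individualisation-refinement), doi:10.4230/lipics.icalp.2024.1 p.5 (symmetry vs resources trade-off), Karp1972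
Equivariant compilation at scale log m: if NP ⊆ P over {0,1} — Cook's classes, `PNPWave0.NP Bool ⊆
PNPWave0.P Bool`, i.e. the negation of PneNP unfolded; equivalent to the former hypothesis
HAMCIRCUIT ∈ Classes.P by the PROVED model bridges P_bool_eq_holds / NP_bool_eq_holds,
HAMCIRCUIT_mem_NP and Karp-completeness of HAM (a prover recovers HAMCIRCUIT ∈ Classes.P in two
lines inside the proof, importing ClayProblemProofs + HamCircuitNP in the Theorems file) — then for
some polynomial p and every m there is a Bud(m,⌊log₂ m⌋)-symmetric threshold circuit of size ≤ p(m)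
computing x ↦ [Gr(x) is Hamiltonian]. The HAM-specific bridge of the route: the deciding theorem
`closes : WindowHam → HamCompiles → PneNP` is pure logic (¬PneNP gives NP Bool ⊆ P Bool; HamCompiles
gives p; WindowHam at p gives m with ¬HasSym; the two `let` vocabularies are syntactically
identical). Restated 2026-08-15 (route-repair) from the hypothesis `HAMCIRCUIT ∈ Classes.P` so that
no Literature fact — in particular the bridge NP_bool_eq, whose discharge is not visible from the
route file — sits in the glue or in the route's cone. An implication with a disbelieved hypothesis,
so it can only be proved by exhibiting t -/
@[route_item "route-PneNP-SymmetryBudget"]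
def HamCompiles : Prop :=
  let Sym : (m : ℕ) → Set (Equiv.Perm (Fin m)) → Literature.Computability.Complexity.Circuit (Fin m × Fin m) → Prop := fun m Γ C => ∀ ρ ∈ Γ, ∃ σ : Equiv.Perm (Fin C.gates.length), Sum.map (fun q : Fin m × Fin m => (ρ q.1, ρ q.2)) (fun k : ℕ => if h : k < C.gates.length then ((σ ⟨k, h⟩ : Fin C.gates.length) : ℕ) else k) C.output = C.output ∧ ∀ j : Fin C.gates.length, (C.gates[σ j]).fn = (C.gates[j]).fn ∧ (List.ofFn (C.gates[σ j]).args).Perm ((List.ofFn (C.gates[j]).args).map (Sum.map (fun q : Fin m × Fin m => (ρ q.1, ρ q.2)) (fun k : ℕ => if h : k < C.gates.length then ((σ ⟨k, h⟩ : Fin C.gates.length) : ℕ) else k))); let HasSym : (m : ℕ) → Set (Equiv.Perm (Fin m)) → ℕ → ((Fin m × Fin m → Bool) → Bool) → Prop := fun m Γ s f => ∃ C : Literature.Computability.Complexity.Circuit (Fin m × Fin m), C.IsOver Literature.Computability.Complexity.tcBasis ∧ C.size ≤ s ∧ Sym m Γ C ∧ C.Computes f; let Bud : (m : ℕ) → ℕ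 → Set (Equiv.Perm (Fin m)) := fun m g => {ρ | ∀ i : Fin m, (i : ℕ) + g < m → ρ i = i}; let Gr : (m : ℕ) → (Fin m × Fin m → Bool) → SimpleGraph (Fin m) := fun m x => SimpleGraph.fromRel fun u v => x (u, v) = true; Literature.Computability.Complexity.PNPWave0.NP Bool ⊆ Literature.Computability.Complexity.PNPWave0.P Bool → ∃ p : Polynomial ℕ, ∀ m : ℕ, HasSym m (Bud m (Nat.log 2 m)) (p.eval m) (fun x : Fin m × Fin m → Bool => decide (Gr m x).IsHamiltonian)

/-- item stmt-PneNP-14781 · crux · rank 4 · closed · moot by None · by planner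
why it might fail: False iff WindowBarrier (the route's first bet: a P-time invariant — TwinIso / square-symmetric CoreFooling (★) pairs — hides order at scale log m); even if true, needs relative canonisation of g = log m free vertices by poly-size symmetric circuits (Subset Discretisation, open; arXiv:1705.03283).
sources: doi:10.1007/s00224-016-9692-2 Thm 1 (FPC → symmetric threshold circuits: compilation template), CaiFurerImmerman1992 §6, arXiv:1705.03283 (Neuen–Schweitzer), doi:10.1145/800061.808746 (Babai–Luks 1983), doi:10.4086/toc.2025.v021a014 §6, tree: Summits/PneNP/PneNP/Cruxes/WindowBarrier/BarrierNotes-r1-k1.md BN2; Summits/PneNP/PneNP/Theorems/WindowBarrier/Negative/InvarianceAndBridge.lean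
[crux] No hidden order at scale log m — the TAME side of the WindowBarrier dichotomy, filed
positively so that it feeds the closes hypothesis HamCompiles (glue item TameCompiles :
NoHiddenOrder → HamCompiles, provable now). Statement: every polynomial-time language L whose graph
slices x ↦ [encode ⟨m, Gr x⟩ ∈ L] are Bud(m,⌊log₂ m⌋)-invariant has, for some polynomial p and all
large m, a Bud(m,⌊log₂ m⌋)-symmetric threshold circuit of size ≤ p(m) for its slice. It is LITERALLY
the classical dual of WindowBarrier (NoHiddenOrder ↔ ¬WindowBarrier by de Morgan +
Filter.not_frequently; kernel-checked in the planner folder, Sketch.lean rc0), so a theorem deciding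
either item decides the other by pure logic. Role in the route: NoHiddenOrder ∧ WindowHam ⊢ PneNP
with no HAM-specific compilation (under ¬PneNP, HAMCIRCUIT ∈ Classes.P by the proved bridges
P_bool_eq_holds / NP_bool_eq_holds / HAMCIRCUIT_mem_NP, its slices are invariant under every vertex
permutation, so NoHiddenOrder hands WindowHam the circuits it forbids; cf. the landed
Theorems/WindowBarrier/Negative/InvarianceAndBridge.lean, ham_not_mem_P_of_not_windowBarrier).
Programme (from the WindowBarrier crux chain, Cruxes/WindowBarri -/
@[route_item "route-PneNP-SymmetryBudget"]
def NoHiddenOrder : Prop :=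
  let Sym : (m : ℕ) → Set (Equiv.Perm (Fin m)) → Literature.Computability.Complexity.Circuit (Fin m × Fin m) → Prop := fun m Γ C => ∀ ρ ∈ Γ, ∃ σ : Equiv.Perm (Fin C.gates.length), Sum.map (fun q : Fin m × Fin m => (ρ q.1, ρ q.2)) (fun k : ℕ => if h : k < C.gates.length then ((σ ⟨k, h⟩ : Fin C.gates.length) : ℕ) else k) C.output = C.output ∧ ∀ j : Fin C.gates.length, (C.gates[σ j]).fn = (C.gates[j]).fn ∧ (List.ofFn (C.gates[σ j]).args).Perm ((List.ofFn (C.gates[j]).args).map (Sum.map (fun q : Fin m × Fin m => (ρ q.1, ρ q.2)) (fun k : ℕ => if h : k < C.gates.length then ((σ ⟨k, h⟩ : Fin C.gates.length) : ℕ) else k))); let HasSym : (m : ℕ) → Set (Equiv.Perm (Fin m)) → ℕ → ((Fin m × Fin m → Bool) → Bool) → Prop := fun m Γ s f => ∃ C : Literature.Computability.Complexity.Circuit (Fin m × Fin m), C.IsOver Literature.Computability.Complexity.tcBasis ∧ C.size ≤ s ∧ Sym m Γ C ∧ C.Computes f; let Bud : (m : ℕ) → ℕ → Set (Equiv.Perm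 (Fin m)) := fun m g => {ρ | ∀ i : Fin m, (i : ℕ) + g < m → ρ i = i}; let Gr : (m : ℕ) → (Fin m × Fin m → Bool) → SimpleGraph (Fin m) := fun m x => SimpleGraph.fromRel fun u v => x (u, v) = true; ∀ L ∈ Literature.Computability.Complexity.Classes.P, (∀ (m : ℕ), ∀ ρ ∈ Bud m (Nat.log 2 m), ∀ x : Fin m × Fin m → Bool, (Literature.Computability.Complexity.encodingGraph.encode ⟨m, Gr m (fun q : Fin m × Fin m => x (ρ q.1, ρ q.2))⟩ ∈ L ↔ Literature.Computability.Complexity.encodingGraph.encode ⟨m, Gr m x⟩ ∈ L)) → ∃ p : Polynomial ℕ, ∀ᶠ m in Filter.atTop, HasSym m (Bud m (Nat.log 2 m)) (p.eval m) (fun x : Fin m × Fin m → Bool => decide (Literature.Computability.Complexity.encodingGraph.encode ⟨m, Gr m x⟩ ∈ L))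

/-- item stmt-PneNP-2145 · support · rank 4 · closed · refuted by Summit.PneNP.PneNP.Theorems.not_WindowBarrier @ b55265987de5 (prover) · by planner
why it might fail: Fails iff every P language with Bud-invariant slices is symmetric-easy at scale log m ('no hidden order'); even if true it may be unprovable for the same reason as WindowHam: no lower-bound method for symmetric circuits with orbits in (2^g, g!) exists (DW ToC 2025 §6).
sources: doi:10.4086/toc.2025.v021a014 §6 (Thms 6.2–6.4), arXiv:1911.08297 §1.3, Prop. 50 (locality barrier template) = Literature.Barriers.PneNP.Locality, doi:10.1016/j.tcs.2008.12.049 (Atserias–Bulatov–Dawar: 𝔽₂-systems vs counting logics), doi:10.1145/800061.808746 (Babai–Luks 1983 canonical labelling), arXiv:1401.1125 Thm 6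
Locality-type barrier inside the window (negative side of the generic bridge): there is a
polynomial-time language L whose graph slices x ↦ [encode ⟨m, Gr x⟩ ∈ L] are Bud(m,⌊log₂
m⌋)-invariant and which, for every polynomial p, infinitely often has no Bud(m,⌊log₂ m⌋)-symmetric
threshold circuit of size ≤ p(m). Equivalent (up to ∃/∃ᶠ) to the negation of 'no hidden order at
scale log m' (every such L has poly-size Bud-symmetric circuits at every m). At this scale the
published witnesses are disarmed — CFI graphs, vertex-variable 𝔽₂-systems and all bounded-domain
CSPs planted on the free part fall to subset-indexed equivariant brute force (orbits ≤ 2^g ≤ m) — so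
a witness must hide order differently: candidates are 𝔽₂-systems whose unknowns live on PAIRS of
free vertices (2^{C(g,2)} subsets) and isomorphism of the free part to the pattern induced on the
first ⌊log₂ m⌋ vertices (in P: Babai–Luks 2^{O(√(g log g))} = m^{o(1)}). If proved it shows that
symmetric lower bounds in the window are not automatically P-hardness results (only HAM-specific
bridges like HamCompiles survive); if refuted, EVERY symmetric lower bound in the window is as
consequential as a general one. Valuable either -/
@[route_item "route-PneNP-SymmetryBudget"]
def WindowBarrier : Prop :=
  let Sym : (m : ℕ) → Set (Equiv.Perm (Fin m)) → Literature.Computability.Complexity.Circuit (Fin m × Fin m) → Prop := fun m Γ C => ∀ ρ ∈ Γ, ∃ σ : Equiv.Perm (Fin C.gates.length), Sum.map (fun q : Fin m × Fin m => (ρ q.1, ρ q.2)) (fun k : ℕ => if h : k < C.gates.length then ((σ ⟨k, h⟩ : Fin C.gates.length) : ℕ) else k) C.output = C.output ∧ ∀ j : Fin C.gates.length, (C.gates[σ j]).fn = (C.gates[j]).fn ∧ (List.ofFn (C.gates[σ j]).args).Perm ((List.ofFn (C.gates[j]).args).map (Sum.map (fun q : Fin m × Fin m => (ρ q.1, ρ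 q.2)) (fun k : ℕ => if h : k < C.gates.length then ((σ ⟨k, h⟩ : Fin C.gates.length) : ℕ) else k))); let HasSym : (m : ℕ) → Set (Equiv.Perm (Fin m)) → ℕ → ((Fin m × Fin m → Bool) → Bool) → Prop := fun m Γ s f => ∃ C : Literature.Computability.Complexity.Circuit (Fin m × Fin m), C.IsOver Literature.Computability.Complexity.tcBasis ∧ C.size ≤ s ∧ Sym m Γ C ∧ C.Computes f; let Bud : (m : ℕ) → ℕ → Set (Equiv.Perm (Fin m)) := fun m g => {ρ | ∀ i : Fin m, (i : ℕ) + g < m → ρ i = i}; let Gr : (m : ℕ) → (Fin m × Fin m → Bool) → SimpleGraph (Fin m) := fun m x => SimpleGraph.fromRel fun u v => x (u, v) = true; ∃ L ∈ Literature.Computability.Complexity.Classes.P, (∀ (m : ℕ), ∀ ρ ∈ Bud m (Nat.log 2 m), ∀ x : Fin m × Fin m → Bool, (Literature.Computability.Complexity.encodingGraph.encode ⟨m, Gr m (fun q : Fin m × Fin m => x (ρ q.1, ρ q.2))⟩ ∈ L ↔ Literature.Computability.Complexity.encodingGraph.encode ⟨m, Gr m x⟩ ∈ L)) ∧ ∀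 p : Polynomial ℕ, ∃ᶠ m in Filter.atTop, ¬ HasSym m (Bud m (Nat.log 2 m)) (p.eval m) (fun x : Fin m × Fin m → Bool => decide (Literature.Computability.Complexity.encodingGraph.encode ⟨m, Gr m x⟩ ∈ L))

/-- item stmt-PneNP-2146 · support · rank 9 · closed · proved by Summit.PneNP.PneNP.Theorems.symmetrise_proof @ ca143396988b (prover) · by planner
why it might fail: Only if the inline Sym predicate is mis-specified (then restate all items over the landed SymmetricCircuit definition) or the constant shape c·g!·(|C|+1) is too tight at m < g (|Bud| = (min g m)!); the g!-symmetrisation sandwich itself is folklore (Anderson–Dawar 2017 §1).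
sources: doi:10.1007/s00224-016-9692-2 §1–2, Vollmer1999 §1.1 (basis conversions), AroraBarak2009 Def. 6.1
The bridge edge of the cliff (elementary, provable now): there is a constant c such that for all m,
g, every Bud(m,g)-invariant f : (Fin m × Fin m → Bool) → Bool and every B2-circuit C computing f,
some Bud(m,g)-symmetric `tcBasis` circuit of size ≤ c·(g!·(|C|+1)) computes f. Proof: rewrite C over
{∧₂,∨₂,¬} (≤ 4 gates per B2 gate), lay out the |Bud| = (min g m)! ≤ g! relabelled copies C∘ρ (ρ ∈
Bud) and conjoin their outputs with one AND gate; ρ' ∈ Bud acts by left multiplication on the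
copies, the AND gate is fixed, argument multisets correspond. Consequences recorded in the
rationale: for g! ≤ poly(m) (g = O(log m/log log m)) 'poly-size Bud-symmetric' = 'poly-size' on
invariant functions, so a symmetric HAM lower bound there is verbatim HAMCIRCUIT ∉ PPoly; also the
canary for the inline Sym predicate (sanity-checked in the planner folder, SymTest.lean). Model:
inputs are m×m Boolean matrices x read as the simple graph Gr(x) = SimpleGraph.fromRel (x(u,v) =
true) (symmetrised, loops dropped, as in encodingGraphFin); Bud(m,g) = permutations of Fin m fixing
every i with i+g < m (last g vertices free); a `tcBasis` circuit C on Fin m × Fin m is Bud-symmetric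
(inline `let Sym`) iff every -/
@[route_item "route-PneNP-SymmetryBudget"]
def Symmetrise : Prop :=
  let Sym : (m : ℕ) → Set (Equiv.Perm (Fin m)) → Literature.Computability.Complexity.Circuit (Fin m × Fin m) → Prop := fun m Γ C => ∀ ρ ∈ Γ, ∃ σ : Equiv.Perm (Fin C.gates.length), Sum.map (fun q : Fin m × Fin m => (ρ q.1, ρ q.2)) (fun k : ℕ => if h : k < C.gates.length then ((σ ⟨k, h⟩ : Fin C.gates.length) : ℕ) else k) C.output = C.output ∧ ∀ j : Fin C.gates.length, (C.gates[σ j]).fn = (C.gates[j]).fn ∧ (List.ofFn (C.gates[σ j]).args).Perm ((List.ofFn (C.gates[j]).args).map (Sum.map (fun q : Fin m × Fin m => (ρ q.1, ρ q.2)) (fun k : ℕ => if h : k < C.gates.length then ((σ ⟨k, h⟩ : Fin C.gates.length) : ℕ) else k))); let HasSym : (m : ℕ) → Set (Equiv.Perm (Fin m)) → ℕ → ((Fin m × Fin m → Bool) → Bool) → Prop := fun m Γ s f => ∃ C : Literature.Computability.Complexity.Circuit (Fin m × Fin m), C.IsOver Literature.Computability.Complexity.tcBasis ∧ C.size ≤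 s ∧ Sym m Γ C ∧ C.Computes f; let Bud : (m : ℕ) → ℕ → Set (Equiv.Perm (Fin m)) := fun m g => {ρ | ∀ i : Fin m, (i : ℕ) + g < m → ρ i = i}; ∃ c : ℕ, ∀ (m g : ℕ) (f : (Fin m × Fin m → Bool) → Bool), (∀ ρ ∈ Bud m g, ∀ x : Fin m × Fin m → Bool, f (fun q : Fin m × Fin m => x (ρ q.1, ρ q.2)) = f x) → ∀ C : Literature.Computability.Complexity.Circuit (Fin m × Fin m), C.IsOver Literature.Computability.Complexity.B2 → C.Computes f → HasSym m (Bud m g) (c * (Nat.factorial g * (C.size + 1))) f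

/-- item stmt-PneNP-2147 · support · rank 10 · closed · proved by Summit.PneNP.PneNP.Theorems.polylogBarrier_proof (prover) · by planner
why it might fail: Step (a) is unpublished in this exact form (subgroup Bud, mixed input vocabulary); constants could force g ≥ (log m)^{2+ε} — then restate with a larger exponent; P-time decodability of the planted CFI instance from a bare graph must be checked (else use an 𝔽₂-system read off triangles).
sources: doi:10.1145/3476227 Thm 4.10, doi:10.4086/toc.2025.v021a014 Thms 6.2–6.4 (p.17), §7, CaiFurerImmerman1992 §6, DawarRicherbyRossman2008 §2, doi:10.1007/s00224-016-9692-2 Thm 6, Lemma 7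
The barrier edge of the cliff for P (theorem-level modulo formalisation): at g = ⌊log₂ m⌋² there is
L ∈ P with Bud(m,g)-invariant graph slices and, for every polynomial p, infinitely many m with no
Bud(m,g)-symmetric threshold circuit of size ≤ p(m) for its slice. Witness: the CFI query (or
solvability of the vertex-variable 𝔽₂-system) planted on the free part over 3-regular expanders,
ignoring the ordered part. Proof plan: (a) transfer Dawar–Wilsenach ToCL 2022 Thm 4.10 (orbit ≤
C(g,k), k ≤ g/4 ⇒ support < k) from Sym_n on x_ij to the point stabiliser Bud acting on circuits
whose inputs also include free–ordered and ordered–ordered entries (unary and nullary relations on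
the free universe) — size m^c ≤ C(g, c·log₂ m) for large m, so supports < c√g; (b) Anderson–Dawar
Thm 6 / DW ToC 2025 Thm 6.4: supports ≤ k ⇒ the decided class is closed under C^{O(k)}-equivalence
of the expanded free-part structures; (c) counting width of the CFI query is linear in g
(Cai–Fürer–Immerman 1992; Dawar–Richerby 2007) > O(√g). NEEDS DEFINITION for the proof (not the
statement): CountingWidth / C^k-equivalence; uses Literature.ModelTheory.FiniteModelTheory.CFI.
Model: inputs are m×m Boolean matrices x -/
@[route_item "route-PneNP-SymmetryBudget"]
def PolylogBarrier : Prop :=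
  let Sym : (m : ℕ) → Set (Equiv.Perm (Fin m)) → Literature.Computability.Complexity.Circuit (Fin m × Fin m) → Prop := fun m Γ C => ∀ ρ ∈ Γ, ∃ σ : Equiv.Perm (Fin C.gates.length), Sum.map (fun q : Fin m × Fin m => (ρ q.1, ρ q.2)) (fun k : ℕ => if h : k < C.gates.length then ((σ ⟨k, h⟩ : Fin C.gates.length) : ℕ) else k) C.output = C.output ∧ ∀ j : Fin C.gates.length, (C.gates[σ j]).fn = (C.gates[j]).fn ∧ (List.ofFn (C.gates[σ j]).args).Perm ((List.ofFn (C.gates[j]).args).map (Sum.map (fun q : Fin m × Fin m => (ρ q.1, ρ q.2)) (fun k : ℕ => if h : k < C.gates.length then ((σ ⟨k, h⟩ : Fin C.gates.length) : ℕ) else k))); let HasSym : (m : ℕ) → Set (Equiv.Perm (Fin m)) → ℕ → ((Fin m × Fin m → Bool) → Bool) → Prop := fun m Γ s f => ∃ C : Literature.Computability.Complexity.Circuit (Fin m × Fin m), C.IsOver Literature.Computability.Complexity.tcBasis ∧ C.size ≤ s ∧ Sym m Γ C ∧ C.Computes f; let Bud : (m : ℕ) → ℕ → Set (Equiv.Perm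 (Fin m)) := fun m g => {ρ | ∀ i : Fin m, (i : ℕ) + g < m → ρ i = i}; let Gr : (m : ℕ) → (Fin m × Fin m → Bool) → SimpleGraph (Fin m) := fun m x => SimpleGraph.fromRel fun u v => x (u, v) = true; ∃ L ∈ Literature.Computability.Complexity.Classes.P, (∀ (m : ℕ), ∀ ρ ∈ Bud m (Nat.log 2 m ^ 2), ∀ x : Fin m × Fin m → Bool, (Literature.Computability.Complexity.encodingGraph.encode ⟨m, Gr m (fun q : Fin m × Fin m => x (ρ q.1, ρ q.2))⟩ ∈ L ↔ Literature.Computability.Complexity.encodingGraph.encode ⟨m, Gr m x⟩ ∈ L)) ∧ ∀ p : Polynomial ℕ, ∃ᶠ m in Filter.atTop, ¬ HasSym m (Bud m (Nat.log 2 m ^ 2)) (p.eval m) (fun x : Fin m × Fin m → Bool => decide (Literature.Computability.Complexity.encodingGraph.encode ⟨m, Gr m x⟩ ∈ L))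

/-- item stmt-PneNP-2148 · support · rank 11 · closed · proved by Summit.PneNP.PneNP.Theorems.polylogHam_proof @ dd9486f82221 (prover) · by planner
why it might fail: Same transfer caveat as PolylogBarrier step (a); Lemma 14 is for Hamiltonian CYCLE on all n-vertex graphs — the planted version needs the Hamiltonian-PATH variant or a different attachment gadget, a routine but unwritten modification.
sources: arXiv:1901.07825 Lemma 14 (p.22), Theorem 2, doi:10.1145/3456297, doi:10.4086/toc.2025.v021a014 Thm 6.4, doi:10.1007/s00224-016-9692-2 Thm 1 ('no polynomial-size family of symmetric majority circuits deciding … Hamiltonicity')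
The barrier edge for HAM itself (theorem-level modulo formalisation): at g = ⌊log₂ m⌋², for every
polynomial p there are infinitely many m with no Bud(m,g)-symmetric threshold circuit of size ≤ p(m)
computing x ↦ [Gr(x) is Hamiltonian]. So beyond the window symmetric HAM lower bounds are theorems
AND imply nothing about P — the calibration that forces the thesis down to g = ⌊log₂ m⌋. Proof plan:
restrict to inputs whose ordered part is a fixed Hamiltonian path with both ends joined to every
free vertex (whole graph Hamiltonian ⇔ free part has a Hamiltonian path), then steps (a)–(b) of
PolylogBarrier and the linear counting width of Hamiltonian path/cycle (Atserias–Dawar–Ochremiak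
arXiv:1901.07825 Lemma 14, via a linear first-order reduction from 3-XOR/3-SAT). Model: inputs are
m×m Boolean matrices x read as the simple graph Gr(x) = SimpleGraph.fromRel (x(u,v) = true)
(symmetrised, loops dropped, as in encodingGraphFin); Bud(m,g) = permutations of Fin m fixing every
i with i+g < m (last g vertices free); a `tcBasis` circuit C on Fin m × Fin m is Bud-symmetric
(inline `let Sym`) iff every ρ ∈ Bud extends to a gate permutation σ fixing the output wire,
preserving gate labels and mappi -/
@[route_item "route-PneNP-SymmetryBudget"]
def PolylogHam : Prop :=
  let Sym : (m : ℕ) → Set (Equiv.Perm (Fin m)) → Literature.Computability.Complexity.Circuit (Fin m × Fin m) → Prop := fun m Γ C => ∀ ρ ∈ Γ, ∃ σ : Equiv.Perm (Fin C.gates.length), Sum.map (fun q : Fin m × Fin m => (ρ q.1, ρ q.2)) (fun k : ℕ => if h : k < C.gates.length then ((σ ⟨k, h⟩ : Fin C.gates.length) : ℕ) else k) C.output = C.output ∧ ∀ j : Fin C.gates.length, (C.gates[σ j]).fn = (C.gates[j]).fn ∧ (List.ofFn (C.gates[σ j]).args).Perm ((List.ofFn (C.gates[j]).args).map (Sum.map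 (fun q : Fin m × Fin m => (ρ q.1, ρ q.2)) (fun k : ℕ => if h : k < C.gates.length then ((σ ⟨k, h⟩ : Fin C.gates.length) : ℕ) else k))); let HasSym : (m : ℕ) → Set (Equiv.Perm (Fin m)) → ℕ → ((Fin m × Fin m → Bool) → Bool) → Prop := fun m Γ s f => ∃ C : Literature.Computability.Complexity.Circuit (Fin m × Fin m), C.IsOver Literature.Computability.Complexity.tcBasis ∧ C.size ≤ s ∧ Sym m Γ C ∧ C.Computes f; let Bud : (m : ℕ) → ℕ → Set (Equiv.Perm (Fin m)) := fun m g => {ρ | ∀ i : Fin m, (i : ℕ) + g < m → ρ i = i}; let Gr : (m : ℕ) → (Fin m × Fin m → Bool) → SimpleGraph (Fin m) := fun m x => SimpleGraph.fromRel fun u v => x (u, v) = true; ∀ p : Polynomial ℕ, ∃ᶠ m in Filter.atTop, ¬ HasSym m (Bud m (Nat.log 2 m ^ 2)) (p.eval m) (fun x : Fin m × Fin m → Bool => decide (Gr m x).IsHamiltonian)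

/-- item stmt-PneNP-2149 · support · rank 12 · closed · moot by None · by planner
why it might fail: False iff NP ⊆ P/poly (Karp–Lipton makes that implausible); as a TARGET it may be unreachable: on rigid inputs the group action is semantically void and Razborov–Rudich natural proofs apply with full force to any constructive argument (the card concedes this).
sources: doi:10.1007/s00224-016-9692-2 Thm 1, Immerman1999 (colour refinement / C² and definable orders), RazborovRudich1997 Thm 4.1 = Literature.Barriers.PneNP.NaturalProofs, KarpLipton1980
The card's rigid-instance benchmark, typed: for every polynomial p, infinitely often no FULLY
Sym(Fin m)-symmetric threshold circuit of size ≤ p(m) agrees with 3-colourability of Gr(x) on all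
colour-refinement-discrete inputs (Discrete: every equitable colouring c : Fin m → Fin m — u,v
equally coloured have equally many neighbours of each colour — is injective, i.e. the coarsest
equitable partition is discrete). On such inputs pebble-game/CFI arguments are void by design (FPC =
P there, Immerman–Lander / Immerman–Vardi on the definable order), so any proof is a genuinely
non-Weisfeiler–Leman symmetric technique. Calibration, not a staffing key: equivalent to
NPNotSubsetPPoly — (⇐) pendant paths of distinct lengths make any graph CR-discrete without changing
3-colourability, so 3COL∩Discrete is NP-complete and symmetric ⊆ general; (⇒) colour refinement and
the induced canonical order are computable by poly-size Sym-symmetric threshold circuits, after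
which any general circuit runs on the canonical adjacency matrix (Anderson–Dawar Thm 1 compilation).
NEEDS DEFINITION (to shorten): ColourRefinementDiscrete. Model: inputs are m×m Boolean matrices x
read as the simple graph Gr(x) = Simp -/
@[route_item "route-PneNP-SymmetryBudget", crux]
def RigidBenchmark : Prop :=
  let Sym : (m : ℕ) → Set (Equiv.Perm (Fin m)) → Literature.Computability.Complexity.Circuit (Fin m × Fin m) → Prop := fun m Γ C => ∀ ρ ∈ Γ, ∃ σ : Equiv.Perm (Fin C.gates.length), Sum.map (fun q : Fin m × Fin m => (ρ q.1, ρ q.2)) (fun k : ℕ => if h : k < C.gates.length then ((σ ⟨k, h⟩ : Fin C.gates.length) : ℕ) else k) C.output = C.output ∧ ∀ j : Fin C.gates.length, (C.gates[σ j]).fn = (C.gates[j]).fn ∧ (List.ofFn (C.gates[σ j]).args).Perm ((List.ofFn (C.gates[j]).args).map (Sum.map (fun q : Fin m × Fin m => (ρ q.1, ρ q.2)) (fun k : ℕ => if h : k < C.gates.length then ((σ ⟨k, h⟩ : Fin C.gates.length) : ℕ) else k))); let Gr : (m : ℕ) → (Fin m × Fin m → Bool) → SimpleGraph (Fin m) :=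 fun m x => SimpleGraph.fromRel fun u v => x (u, v) = true; let Discrete : (m : ℕ) → SimpleGraph (Fin m) → Prop := fun m G => ∀ c : Fin m → Fin m, (∀ u v : Fin m, c u = c v → ∀ y : Fin m, Nat.card {w : Fin m // G.Adj u w ∧ c w = y} = Nat.card {w : Fin m // G.Adj v w ∧ c w = y}) → Function.Injective c; ∀ p : Polynomial ℕ, ∃ᶠ m in Filter.atTop, ¬ ∃ C : Literature.Computability.Complexity.Circuit (Fin m × Fin m), C.IsOver Literature.Computability.Complexity.tcBasis ∧ C.size ≤ p.eval m ∧ Sym m Set.univ C ∧ ∀ x : Fin m × Fin m → Bool, Discrete m (Gr m x) → C.eval x = decide ((Gr m x).Colorable 3)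

/-- item stmt-PneNP-14852 · support · rank 13 · closed · proved by Summit.PneNP.PneNP.Theorems.tameCompiles_proof (prover) · by planner
[support] Glue (provable now; PROVED in the planner folder, TameSketch.lean rc0, 0 sorry, axioms
propext/Classical.choice/Quot.sound): NoHiddenOrder → HamCompiles — the tame branch of the
WindowBarrier dichotomy feeds the closes hypothesis HamCompiles, so WindowHam ∧ NoHiddenOrder ⊢
PneNP through the route's deciding theorem. Proof (15 lines): assume NoHiddenOrder and NP ⊆ P over
{0,1} (HamCompiles' hypothesis, Cook classes PNPWave0.NP Bool ⊆ PNPWave0.P Bool); then HAMCIRCUIT ∈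
Classes.P by the PROVED model bridges P_bool_eq_holds (PNPWave0.P Bool = Classes.P),
NP_bool_eq_holds (PNPWave0.NP Bool = Nondeterministic.NP) and HAMCIRCUIT_mem_NP; its graph slices
are invariant under every vertex permutation (isHamiltonian_relabel_iff) and equal x ↦ [Gr x is
Hamiltonian] (encode_mem_HAMCIRCUIT_iff; both in
Theorems/WindowBarrier/Negative/InvarianceAndBridge.lean), so NoHiddenOrder yields a polynomial p
with Bud(m,⌊log₂ m⌋)-symmetric threshold circuits of size ≤ p(m) for all m ≥ N; pad the finitely
many m < N with the symmetric DNF (Literature hasSymCircuit_of_invariant: every invariant f has a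
Γ-symmetric tcBasis circuit of size 2^(m²)+m²+1) and take p + C(2^(N²)+N²+1). WHY IT MIGHT FAIL: -/
@[route_item "route-PneNP-SymmetryBudget"]
def TameCompiles : Prop :=
  NoHiddenOrder → HamCompiles

-- earlier Assembly (stmt-PneNP-2150, replaced 2026-08-15T16:19:55Z -> stmt-PneNP-10638): retired by None — (let Sym : (m : ℕ) → Set (Equiv.Perm (Fin m)) → Literature.Computability.Complexity.Circuit (Fin m × Fin m) → Prop := fun m Γ C => ∀ ρ ∈ Γ, ∃ σ : Equiv.Perm (Fin C.gates.length), Sum.map (fun q : Fin m × Fin m => (ρ q.1, ρ q.2)) (fun k : ℕ => if h : k < C.gates.length then ((σ ⟨k, h⟩ : Fin C.ga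
/-- item stmt-PneNP-10638 · assembly · rank 1 · closed · proved by Summit.PneNP.PneNP.Theorems.assembly_proof (prover) · by planner
sources: CookClay2006 §1, Summit.PneNP.PneNP.Theses.SymmetryBudget.closes (deciding theorem, pure logic)
WindowHam → HamCompiles → PneNP (the two hypotheses written inline, syntactically identical to the
decls WindowHam and HamCompiles). Proof (pure logic, no Literature fact; it is literally the route's
deciding theorem `closes`, restated 2026-08-15 from the former `WindowHam → HamCompiles → P_bool_eq
→ NP_bool_eq → PneNP` once HamCompiles took the hypothesis NP Bool ⊆ P Bool): assume ¬PneNP, i.e.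
every L ∈ PNPWave0.NP Bool lies in PNPWave0.P Bool, so NP Bool ⊆ P Bool; HamCompiles yields a
polynomial p with Bud(m,⌊log₂ m⌋)-symmetric threshold circuits of size ≤ p(m) for x ↦
[Gr(x).IsHamiltonian] at EVERY m, contradicting WindowHam at p (∃ᶠ m, ¬HasSym gives an m). The two
inline `let` vocabularies in the hypotheses are syntactically identical, so the contradiction is
literal. Provable now (a prover may even cite `closes`). -/
@[route_item "route-PneNP-SymmetryBudget"]
def Assembly : Prop :=
  (let Sym : (m : ℕ) → Set (Equiv.Perm (Fin m)) → Literature.Computability.Complexity.Circuit (Fin m × Fin m) → Prop := fun m Γ C => ∀ ρ ∈ Γ, ∃ σ : Equiv.Perm (Fin C.gates.length), Sum.map (fun q : Fin m × Fin m => (ρ q.1, ρ q.2)) (fun k : ℕ => if h : k < C.gates.length then ((σ ⟨k, h⟩ : Fin C.gates.length) : ℕ) else k) C.output = C.output ∧ ∀ j : Fin C.gates.length, (C.gates[σ j]).fn = (C.gates[j]).fn ∧ (List.ofFn (C.gates[σ j]).args).Perm ((List.ofFn (C.gates[j]).args).map (Sum.map (fun q : Fin m × Fin m => (ρ q.1,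 ρ q.2)) (fun k : ℕ => if h : k < C.gates.length then ((σ ⟨k, h⟩ : Fin C.gates.length) : ℕ) else k))); let HasSym : (m : ℕ) → Set (Equiv.Perm (Fin m)) → ℕ → ((Fin m × Fin m → Bool) → Bool) → Prop := fun m Γ s f => ∃ C : Literature.Computability.Complexity.Circuit (Fin m × Fin m), C.IsOver Literature.Computability.Complexity.tcBasis ∧ C.size ≤ s ∧ Sym m Γ C ∧ C.Computes f; let Bud : (m : ℕ) → ℕ → Set (Equiv.Perm (Fin m)) := fun m g => {ρ | ∀ i : Fin m, (i : ℕ) + g < m → ρ i = i}; let Gr : (m : ℕ) → (Fin m × Fin m → Bool) → SimpleGraph (Fin m) := fun m x => SimpleGraph.fromRel fun u v => x (u, v) = true; ∀ p : Polynomial ℕ, ∃ᶠ m in Filter.atTop, ¬ HasSym m (Bud m (Nat.log 2 m)) (p.eval m) (fun x : Fin m × Fin m → Bool => decide (Gr m x).IsHamiltonian)) → (let Sym : (m : ℕ) → Set (Equiv.Perm (Fin m)) → Literature.Computability.Complexity.Circuit (Fin m × Fin m) → Prop := fun m Γ C => ∀ ρ ∈ Γ, ∃ σ : Equiv.Perm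 (Fin C.gates.length), Sum.map (fun q : Fin m × Fin m => (ρ q.1, ρ q.2)) (fun k : ℕ => if h : k < C.gates.length then ((σ ⟨k, h⟩ : Fin C.gates.length) : ℕ) else k) C.output = C.output ∧ ∀ j : Fin C.gates.length, (C.gates[σ j]).fn = (C.gates[j]).fn ∧ (List.ofFn (C.gates[σ j]).args).Perm ((List.ofFn (C.gates[j]).args).map (Sum.map (fun q : Fin m × Fin m => (ρ q.1, ρ q.2)) (fun k : ℕ => if h : k < C.gates.length then ((σ ⟨k, h⟩ : Fin C.gates.length) : ℕ) else k))); let HasSym : (m : ℕ) → Set (Equiv.Perm (Fin m)) → ℕ → ((Fin m × Fin m → Bool) → Bool) → Prop := fun m Γ s f => ∃ C : Literature.Computability.Complexity.Circuit (Fin m × Fin m), C.IsOver Literature.Computability.Complexity.tcBasis ∧ C.size ≤ s ∧ Sym m Γ C ∧ C.Computes f; let Bud : (m : ℕ) → ℕ → Set (Equiv.Perm (Fin m)) := fun m g => {ρ | ∀ i : Fin m, (i : ℕ) + g < m → ρ i = i}; let Gr : (m : ℕ) → (Fin m × Fin m → Bool) → SimpleGraph (Fin m) := fun m x => SimpleGraph.fromRel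 fun u v => x (u, v) = true; Literature.Computability.Complexity.PNPWave0.NP Bool ⊆ Literature.Computability.Complexity.PNPWave0.P Bool → ∃ p : Polynomial ℕ, ∀ m : ℕ, HasSym m (Bud m (Nat.log 2 m)) (p.eval m) (fun x : Fin m × Fin m → Bool => decide (Gr m x).IsHamiltonian)) → PneNP

end Summit.PneNP.PneNP.Theses.SymmetryBudget
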